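import Mathlib.Analysis.Distribution.FourierMultiplier
import Mathlib.Analysis.Distribution.SchwartzSpace.Fourier
import Mathlib.Analysis.Distribution.Sobolev
import Mathlib.Analysis.InnerProductSpace.PiL2
import Mathlib.Analysis.SpecialFunctions.Pow.Integral
import Literature.MathematicalPhysics.QuantumLattice.RandomField
import Literature.MathematicalPhysics.QuantumLattice.EuclideanAction
import HarnessLib

-- provenance: harness21/H21/H21/Prelude/QLatticeAQFT/FreeCovariance.lean @ b6a64e5 (interim HEAD d8f2665); M5 mechanical rewrite
/-!
# The free covariance `C_m = (-Δ + m²)⁻¹` on Schwartz space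

Trunk **T-AQFT** (G13, Part A, item A4), families `constructive-qft`, `crit-ising`.
Notion: `free_field_covariance`.

The covariance of the free (Gaussian) Euclidean scalar field of mass `m` on a finite-dimensional
real inner product space `E` (typically `E = EuclideanSpace ℝ (Fin d)`) is the operator
`C_m = (-Δ + m²)⁻¹`, i.e. the Fourier multiplier with symbol `(|p|² + m²)⁻¹`. This file provides

* `Literature.AQFT.freeSymbol m ξ = ((2π‖ξ‖)² + m²)⁻¹`, the symbol of `C_m` in Mathlib's Fourier
  convention (kernel `e^{-2πi⟪x, ξ⟫}`, so that `-Δ ↔ (2π‖ξ‖)²`; this is the same convention as the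
  accepted `Literature.heatSymbol t ξ = exp (-(2π)² t ‖ξ‖²)` of `H21/Prelude/UnbddOp/HeatKernel.lean`, so
  that formally `freeSymbol m ξ = ∫₀^∞ e^{-m² t} heatSymbol t ξ dt`);
* `Literature.AQFT.freeCovarianceOp m : 𝓢(E, ℂ) →L[ℂ] 𝓢(E, ℂ)`, the operator `C_m` as a Fourier
  multiplier on complex Schwartz functions (Mathlib `SchwartzMap.fourierMultiplierCLM`);
* the sesquilinear form `Literature.AQFT.freeCovariance m f g = ∫ conj (𝓕 f ξ) 𝓕 g ξ freeSymbol m ξ dξ`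
  (`= ⟪f, C_m g⟫_{L²}`), its real restriction `freeCovarianceReal`, the massless case
  `freeCovarianceMassless` (`m = 0`, meaningful when `3 ≤ dim E`);
* the predicate `Literature.AQFT.IsFreeField m μ`: `μ` is the law of the free field of mass `m`, i.e. the
  centred Gaussian measure on `FieldConfig E` with generating functional
  `S(f) = exp (-½ C_m(f, f))`;
* API. Proved here (elementary, valid for every `m`, junk cases included): Hermitian symmetry
  `freeCovariance_conj_symm`, positivity `freeCovariance_self_nonneg`, and their real
  restrictions `freeCovarianceReal_comm`, `freeCovarianceReal_self_nonneg`; Euclidean invariance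
  `freeCovariance_euclidAct` / `freeCovarianceReal_euclidAct` and real reflection positivity
  `freeCovarianceReal_reflectionPositive` are witness theorems over the named facts below.
  Also proved outright from Mathlib: temperate growth of the symbol
  (`freeSymbol_hasTemperateGrowth`), integrability of the momentum-space integrand
  (`integrable_freeSymbol_mul` for `m ≠ 0`, `integrable_freeSymbol_zero_mul` for `m = 0` in
  dimension `≥ 3`), the multiplier identity `fourier_freeCovarianceOp_apply` and the Plancherel
  form `freeCovariance_eq_integral_mul_op` (`C_m(f, g) = ⟪f, C_m g⟫_{L²}`, from
  `SchwartzMap.integral_inner_fourier_fourier`).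
  Named facts (D-0014, `def X : Prop`, cited): nondegeneracy, joint continuity
  (`continuous_freeCovarianceReal`), translation and isometry invariance
  (`freeCovariance_translate`, `freeCovariance_linAct`) and reflection positivity
  (`freeCovariance_reflectionPositive` for `m ≠ 0`,
  `freeCovarianceMassless_reflectionPositive` for `m = 0`, `d ≥ 3`).
  Discharged here: `freeCovariance_translate_holds : freeCovariance_translate` (section
  `Discharge` at the end: the phase identity `fourier_translateTest_apply`,
  `𝓕 (f(· - a)) ξ = 𝐞(-⟪a, ξ⟫) • 𝓕 f ξ` from Mathlib's
  `VectorFourier.fourierIntegral_comp_add_right`, and `|𝐞(·)|² = 1`).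
  Discharge note: `freeCovariance_linAct` is likewise Mathlib-level bookkeeping
  (`Real.fourier_comp_linearIsometry` and `LinearIsometryEquiv.measurePreserving`) and is a
  candidate for a `--kind proof` discharge.

## Sources

* J. Glimm, A. Jaffe, *Quantum Physics: a functional integral point of view* (2nd ed. 1987),
  §6.2: (6.2.1) `C(f, g) ≡ ⟨f, C g⟩` for a positive continuous nondegenerate bilinear form on
  `𝓢 × 𝓢`; (6.2.10) `C = (-Δ + m²)⁻¹`; Thm. 6.2.2 (RP of `dφ_C` iff RP of `C`); Thm. 6.2.4 with
  (6.2.8), (6.2.11) (generalized free fields, `dρ = δ_{m²}`; in `d ≥ 3` the mass `m = 0` is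
  admitted and the Gaussian measure is reflection positive and invariant); Prop. 6.2.5
  (`C = (-Δ + m²)⁻¹` is reflection positive); §7.10, Thm. 7.10.1 (unit mass, boundary conditions).
* K. Osterwalder, R. Schrader, *Axioms for Euclidean Green's functions I, II*, Comm. Math.
  Phys. 31 (1973) 83–112; 42 (1975) 281–305 (background; not cited by tag).

## Mathlib

Used: `SchwartzMap.fourierMultiplierCLM` (`Analysis/Distribution/FourierMultiplier.lean`),
`SchwartzMap.fourierTransformCLM` / the `𝓕` notation (`open scoped FourierTransform`),
`Function.HasTemperateGrowth`, `Function.hasTemperateGrowth_one_add_norm_sq_rpow`, the canonical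
`volume` on a finite-dimensional inner product space (`measureSpaceOfInnerProductSpace`).
Relation to Mathlib's Bessel potential `TemperedDistribution.besselPotential E F s` (Fourier
multiplier with `(1 + ‖ξ‖²)^{s/2}`, i.e. `(1 - (2π)⁻² Δ)^{s/2}`): on tempered distributions,
`C_m = (2π)⁻² · besselPotential E ℂ (-2)` for the mass `m = 2π`; for general `m` the two differ by
the dilation `ξ ↦ (2π/m) ξ`. Mathlib has no free covariance / free field (searched
`freeCovariance`, `Klein`, `IsFreeField`, `covariance` in `Analysis/Distribution`).

## Design

* Everything is stated for a finite-dimensional real inner product space `E` with its Borel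
  σ-algebra (`[MeasurableSpace E] [BorelSpace E]`, volume = Lebesgue measure normalised on
  orthonormal cubes), exactly the setting of `SchwartzMap.fourierMultiplierCLM`; reflection
  positivity is at `E = EuclideanSpace ℝ (Fin d)`, where `thetaTest d` lives.
* `freeSymbol m` depends on `m` only through `m²`; hypotheses are `m ≠ 0` (massive) or
  `3 ≤ finrank ℝ E` (massless, where `‖ξ‖⁻²` is locally integrable), never `0 < m`.
* Junk values. `freeCovariance` is a Bochner integral, hence `0` if the integrand is not
  integrable (only possible for `m = 0` and `dim E ≤ 2`, see `integrable_freeSymbol_mul`,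
  `integrable_freeSymbol_zero_mul`). `freeCovarianceOp 0 = 0`: Mathlib's `smulLeftCLM` is `0` on
  symbols without temperate growth and `freeSymbol 0 = (2π‖ξ‖)⁻²` is singular at `0`; the massless
  covariance is therefore only provided as the form `freeCovarianceMassless`.
* `freeCovariance m f g` is conjugate-linear in `f` (physics convention `⟪f, C g⟫`), so reflection
  positivity reads `0 ≤ freeCovariance m (thetaTest d f) f`, which is Glimm–Jaffe's
  `⟨θ f, C f⟩_{L²} ≥ 0` (their inner product is also conjugate-linear in the first slot).
-/

open scoped SchwartzMap ComplexConjugate FourierTransform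
open MeasureTheory Complex Real

namespace Literature.MathematicalPhysics.QuantumLattice

/-! ### The symbol -/

section Symbol

variable {E : Type*} [NormedAddCommGroup E]

/-- The *free symbol* of mass `m`: `freeSymbol m ξ = ((2π‖ξ‖)² + m²)⁻¹`, the Fourier multiplier
of `C_m = (-Δ + m²)⁻¹` in Mathlib's Fourier convention (`-Δ` has symbol `(2π‖ξ‖)²`; compare
`Literature.heatSymbol t ξ = exp (-(2π)² t ‖ξ‖²)`). Junk: for `m = 0` and `ξ = 0` the value is `0⁻¹ = 0`.
Glimm–Jaffe §6.2, eq. (6.2.10). [folklore] -/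
noncomputable def freeSymbol (m : ℝ) (ξ : E) : ℝ :=
  ((2 * π * ‖ξ‖) ^ 2 + m ^ 2)⁻¹

/-- Unfolding lemma for `freeSymbol` (Glimm–Jaffe §6.2). [folklore] -/
theorem freeSymbol_apply (m : ℝ) (ξ : E) :
    freeSymbol m ξ = ((2 * π * ‖ξ‖) ^ 2 + m ^ 2)⁻¹ := rfl

/-- The free symbol is nonnegative (Glimm–Jaffe §6.2). [folklore] -/
theorem freeSymbol_nonneg (m : ℝ) (ξ : E) : 0 ≤ freeSymbol m ξ := by
  unfold freeSymbol
  positivity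

/-- For `m ≠ 0` the free symbol is strictly positive (Glimm–Jaffe §6.2). [folklore] -/
theorem freeSymbol_pos {m : ℝ} (hm : m ≠ 0) (ξ : E) : 0 < freeSymbol m ξ := by
  unfold freeSymbol
  positivity

/-- For `m ≠ 0` the free symbol is bounded by `m⁻²` (Glimm–Jaffe §6.2: `‖C_m‖ = m⁻²` on `L²`).
[folklore] -/
theorem freeSymbol_le {m : ℝ} (hm : m ≠ 0) (ξ : E) : freeSymbol m ξ ≤ (m ^ 2)⁻¹ := by
  unfold freeSymbol
  exact inv_anti₀ (by positivity) (le_add_of_nonneg_left (sq_nonneg _))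

/-- The free symbol only depends on `m²`: `freeSymbol (-m) = freeSymbol m`. [folklore] -/
@[simp]
theorem freeSymbol_neg (m : ℝ) : freeSymbol (E := E) (-m) = freeSymbol m := by
  funext ξ
  simp [freeSymbol]

/-- For `m ≠ 0` the free symbol `ξ ↦ ((2π‖ξ‖)² + m²)⁻¹` has temperate growth (it is smooth with
bounded derivatives on an inner product space), so that it defines a Fourier multiplier on `𝓢`.
Proof: `freeSymbol m = m⁻² · (1 + ‖·‖²)⁻¹ ∘ ((2π/m) • id)`, and Mathlib's
`Function.hasTemperateGrowth_one_add_norm_sq_rpow` composed with a continuous linear map has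
temperate growth. [folklore] -/
theorem freeSymbol_hasTemperateGrowth {V : Type*} [NormedAddCommGroup V] [InnerProductSpace ℝ V]
    {m : ℝ} (hm : m ≠ 0) : Function.HasTemperateGrowth (freeSymbol (E := V) m) := by
  have h := ((Function.hasTemperateGrowth_one_add_norm_sq_rpow V (-1)).comp
    ((2 * π / m) • ContinuousLinearMap.id ℝ V).hasTemperateGrowth)
  have heq : freeSymbol (E := V) m =
      fun ξ => (m ^ 2)⁻¹ * (1 + ‖(2 * π / m) • ξ‖ ^ 2) ^ (-1 : ℝ) := by
    funext ξ
    simp only [freeSymbol, Real.rpow_neg_one, norm_smul, Real.norm_eq_abs, mul_pow, sq_abs,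
      div_pow]
    field_simp
    ring
  rw [heq]
  exact (Function.HasTemperateGrowth.const _).mul h

end Symbol

/-! ### The covariance operator and form -/

section Covariance

variable {E : Type*} [NormedAddCommGroup E] [InnerProductSpace ℝ E] [FiniteDimensional ℝ E]
  [MeasurableSpace E] [BorelSpace E]

/-- The free covariance operator `C_m = (-Δ + m²)⁻¹` on complex Schwartz functions, as the
Fourier multiplier with symbol `freeSymbol m` (Mathlib `SchwartzMap.fourierMultiplierCLM`):
`C_m g = 𝓕⁻¹ (freeSymbol m • 𝓕 g)`. Junk: `freeCovarianceOp 0 = 0` (the massless symbol has no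
temperate growth and Mathlib's multiplier is then `0`). Glimm–Jaffe §6.2, eq. (6.2.10).
[folklore] -/
noncomputable def freeCovarianceOp (m : ℝ) : 𝓢(E, ℂ) →L[ℂ] 𝓢(E, ℂ) :=
  SchwartzMap.fourierMultiplierCLM ℂ fun ξ : E => (freeSymbol m ξ : ℂ)

/-- The free covariance as a sesquilinear form on complex test functions, in momentum space:
`C_m(f, g) = ∫ conj (𝓕 f ξ) · 𝓕 g ξ · ((2π‖ξ‖)² + m²)⁻¹ dξ = ⟪f, C_m g⟫_{L²}`
(conjugate-linear in `f`). Bochner integral: junk value `0` if not integrable, which only happens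
for `m = 0` in dimension `≤ 2`. Glimm–Jaffe §6.2, eqs. (6.2.1), (6.2.10). [folklore] -/
noncomputable def freeCovariance (m : ℝ) (f g : 𝓢(E, ℂ)) : ℂ :=
  ∫ ξ, conj ((𝓕 f : 𝓢(E, ℂ)) ξ) * (𝓕 g : 𝓢(E, ℂ)) ξ * (freeSymbol m ξ : ℂ)

/-- The free covariance on *real* test functions,
`C_m(f, g) = re ∫ conj (𝓕 f ξ) 𝓕 g ξ ((2π‖ξ‖)² + m²)⁻¹ dξ` (the integral is already real by
`freeCovariance_conj_symm` and `𝓕 f (-ξ) = conj (𝓕 f ξ)` for real `f`). This is the covariance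
of the free field as a bilinear form on `𝓢(E, ℝ)`. Glimm–Jaffe §6.2. [folklore] -/
noncomputable def freeCovarianceReal (m : ℝ) (f g : 𝓢(E, ℝ)) : ℝ :=
  (freeCovariance m (ofRealTest f) (ofRealTest g)).re

/-- The massless free covariance `C_0(f, g) = ∫ conj (𝓕 f ξ) 𝓕 g ξ (2π‖ξ‖)⁻² dξ`, i.e.
`(-Δ)⁻¹` as a form. Meaningful (integrand integrable for all Schwartz `f, g`) iff
`3 ≤ finrank ℝ E`, see `integrable_freeSymbol_zero_mul`; junk `0` otherwise when not integrable.
Glimm–Jaffe §6.2, Thm. 6.2.4 with (6.2.8), (6.2.11) (`dρ = δ₀` is admitted for `d ≥ 3`).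
[folklore] -/
noncomputable def freeCovarianceMassless (f g : 𝓢(E, ℂ)) : ℂ :=
  freeCovariance 0 f g

/-- Unfolding lemma: `freeCovarianceMassless = freeCovariance 0`. [folklore] -/
@[simp]
theorem freeCovarianceMassless_eq (f g : 𝓢(E, ℂ)) :
    freeCovarianceMassless f g = freeCovariance 0 f g := rfl

/-- `μ` is the law of the *free Euclidean field of mass `m`* over `E`: a centred Gaussian measure
on field configurations whose generating functional is `S(f) = exp (-½ C_m(f, f))` for every
real test function `f`, with `C_m = (-Δ + m²)⁻¹`. Glimm–Jaffe §6.2, (6.2.1)–(6.2.2) with the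
existence and uniqueness statement following (6.2.1) (via Minlos), and (6.2.10). [folklore] -/
def IsFreeField (m : ℝ) (μ : Measure (FieldConfig E)) : Prop :=
  IsGaussianField μ ∧
    ∀ f : 𝓢(E, ℝ), genFunctional μ f = cexp (-(1 / 2 : ℂ) * (freeCovarianceReal m f f : ℂ))

/-! ### API -/

omit [FiniteDimensional ℝ E] [MeasurableSpace E] [BorelSpace E] in
/-- Schwartz functions are bounded by the norm of the associated bounded continuous function.
[folklore] -/
theorem norm_apply_le_norm_toBCF (f : 𝓢(E, ℂ)) (ξ : E) :
    ‖f ξ‖ ≤ ‖f.toBoundedContinuousFunction‖ :=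
  f.toBoundedContinuousFunction.norm_coe_le_norm ξ

/-- The product `conj (𝓕 f) · 𝓕 g` of Fourier transforms of Schwartz functions is integrable
(bounded times integrable). [folklore] -/
theorem integrable_conj_fourier_mul_fourier (f g : 𝓢(E, ℂ)) :
    Integrable fun ξ : E => conj ((𝓕 f : 𝓢(E, ℂ)) ξ) * (𝓕 g : 𝓢(E, ℂ)) ξ := by
  refine Integrable.bdd_mul (c := ‖(𝓕 f : 𝓢(E, ℂ)).toBoundedContinuousFunction‖)
    (𝓕 g : 𝓢(E, ℂ)).integrable
    (Complex.continuous_conj.comp (𝓕 f : 𝓢(E, ℂ)).continuous).aestronglyMeasurable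
    (ae_of_all _ fun ξ => ?_)
  simpa only [RCLike.norm_conj] using norm_apply_le_norm_toBCF (𝓕 f) ξ

omit [InnerProductSpace ℝ E] [FiniteDimensional ℝ E] [MeasurableSpace E] [BorelSpace E] in
/-- The free symbol is continuous for `m ≠ 0`. [folklore] -/
theorem continuous_freeSymbol {m : ℝ} (hm : m ≠ 0) : Continuous (freeSymbol (E := E) m) := by
  unfold freeSymbol
  exact Continuous.inv₀ (by fun_prop) fun ξ => (by positivity : (0 : ℝ) < _).ne'

/-- For `m ≠ 0` the momentum-space integrand of `freeCovariance m f g` is integrable (the symbol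
is bounded by `m⁻²` and `𝓕 f, 𝓕 g ∈ 𝓢 ⊆ L¹ ∩ L^∞`). Proved from Mathlib. Glimm–Jaffe §6.2,
(6.2.1) with (6.2.10). [folklore] -/
theorem integrable_freeSymbol_mul {m : ℝ} (hm : m ≠ 0) (f g : 𝓢(E, ℂ)) :
    Integrable fun ξ : E =>
      conj ((𝓕 f : 𝓢(E, ℂ)) ξ) * (𝓕 g : 𝓢(E, ℂ)) ξ * (freeSymbol m ξ : ℂ) := by
  refine (integrable_conj_fourier_mul_fourier f g).mul_bdd (c := (m ^ 2)⁻¹)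
    (Complex.continuous_ofReal.comp (continuous_freeSymbol hm)).aestronglyMeasurable
    (ae_of_all _ fun ξ => ?_)
  simp only [Complex.norm_of_nonneg (freeSymbol_nonneg m ξ)]
  exact freeSymbol_le hm ξ

omit [InnerProductSpace ℝ E] [FiniteDimensional ℝ E] [MeasurableSpace E] [BorelSpace E] in
/-- The massless symbol is `(2π)⁻² ‖ξ‖⁻²` (as a real power; both sides are `0` at `ξ = 0`).
[folklore] -/
theorem freeSymbol_zero_eq_rpow (ξ : E) :
    freeSymbol 0 ξ = ((2 * π) ^ 2)⁻¹ * ‖ξ‖ ^ (-2 : ℝ) := by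
  rw [Real.rpow_neg (norm_nonneg ξ), Real.rpow_two]
  simp only [freeSymbol, mul_pow, ne_eq, OfNat.ofNat_ne_zero, not_false_eq_true, zero_pow,
    add_zero, mul_inv]

omit [InnerProductSpace ℝ E] [FiniteDimensional ℝ E] [MeasurableSpace E] [BorelSpace E] in
/-- Away from the unit ball the massless symbol is bounded by `(2π)⁻²`. [folklore] -/
theorem freeSymbol_zero_le {ξ : E} (hξ : 1 ≤ ‖ξ‖) : freeSymbol 0 ξ ≤ ((2 * π) ^ 2)⁻¹ := by
  simp only [freeSymbol, ne_eq, OfNat.ofNat_ne_zero, not_false_eq_true, zero_pow, add_zero]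
  refine inv_anti₀ (by positivity) ?_
  have h1 : 1 ≤ ‖ξ‖ ^ 2 := one_le_pow₀ hξ
  nlinarith [mul_nonneg (sub_nonneg.2 h1) (sq_nonneg π)]

/-- In dimension `≥ 3` the massless integrand `conj (𝓕 f) 𝓕 g (2π‖ξ‖)⁻²` is integrable
(`‖ξ‖⁻²` is integrable on the unit ball iff `dim E ≥ 3`, Mathlib
`integrableOn_ball_of_norm_le_rpow`; outside the ball the symbol is bounded). Proved from Mathlib.
Glimm–Jaffe §6.2, Thm. 6.2.4 with (6.2.8), (6.2.11) (`m = 0` admitted for `d ≥ 3`). [folklore] -/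
theorem integrable_freeSymbol_zero_mul (hE : 3 ≤ Module.finrank ℝ E) (f g : 𝓢(E, ℂ)) :
    Integrable fun ξ : E =>
      conj ((𝓕 f : 𝓢(E, ℂ)) ξ) * (𝓕 g : 𝓢(E, ℂ)) ξ * (freeSymbol 0 ξ : ℂ) := by
  set P : E → ℂ := fun ξ => conj ((𝓕 f : 𝓢(E, ℂ)) ξ) * (𝓕 g : 𝓢(E, ℂ)) ξ with hP
  have hPi : Integrable P := integrable_conj_fourier_mul_fourier f g
  have hmeas : AEStronglyMeasurable (fun ξ : E => P ξ * (freeSymbol 0 ξ : ℂ)) volume := by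
    refine hPi.aestronglyMeasurable.mul (Complex.measurable_ofReal.comp ?_).aestronglyMeasurable
    unfold freeSymbol
    fun_prop
  have hnorm : ∀ ξ, ‖P ξ * (freeSymbol 0 ξ : ℂ)‖ = ‖P ξ‖ * freeSymbol 0 ξ := fun ξ => by
    rw [norm_mul, Complex.norm_of_nonneg (freeSymbol_nonneg 0 ξ)]
  rw [← integrableOn_univ, ← Set.union_compl_self (Metric.ball (0 : E) 1)]
  refine IntegrableOn.union ?_ ?_
  · -- near the origin: `‖P ξ‖ freeSymbol 0 ξ ≤ C ‖ξ‖^(-2)` and `2 < dim E`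
    set C : ℝ := ‖(𝓕 f : 𝓢(E, ℂ)).toBoundedContinuousFunction‖ *
      ‖(𝓕 g : 𝓢(E, ℂ)).toBoundedContinuousFunction‖ * ((2 * π) ^ 2)⁻¹
    refine integrableOn_ball_of_norm_le_rpow (by omega) (C := C) (α := 2)
      (by exact_mod_cast (by omega : 2 < Module.finrank ℝ E)) (ae_of_all _ fun ξ => ?_) hmeas
    rw [hnorm, freeSymbol_zero_eq_rpow]
    simp only [hP, norm_mul, RCLike.norm_conj]
    calc ‖(𝓕 f : 𝓢(E, ℂ)) ξ‖ * ‖(𝓕 g : 𝓢(E, ℂ)) ξ‖ * (((2 * π) ^ 2)⁻¹ * ‖ξ‖ ^ (-2 : ℝ))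
        ≤ ‖(𝓕 f : 𝓢(E, ℂ)).toBoundedContinuousFunction‖ *
            ‖(𝓕 g : 𝓢(E, ℂ)).toBoundedContinuousFunction‖ *
            (((2 * π) ^ 2)⁻¹ * ‖ξ‖ ^ (-2 : ℝ)) :=
          mul_le_mul_of_nonneg_right (mul_le_mul (norm_apply_le_norm_toBCF _ _)
            (norm_apply_le_norm_toBCF _ _) (norm_nonneg _) (norm_nonneg _))
            (mul_nonneg (by positivity) (Real.rpow_nonneg (norm_nonneg ξ) _))
      _ = C * ‖ξ‖ ^ (-2 : ℝ) := by simp only [C]; ring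
  · -- away from the origin: the symbol is bounded by `(2π)⁻²`
    refine Integrable.mono' ((hPi.norm.mul_const ((2 * π) ^ 2)⁻¹).integrableOn) hmeas.restrict ?_
    refine (ae_restrict_iff' Metric.isOpen_ball.measurableSet.compl).mpr
      (ae_of_all _ fun ξ hξ => ?_)
    rw [hnorm]
    refine mul_le_mul_of_nonneg_left (freeSymbol_zero_le ?_) (norm_nonneg _)
    simpa using hξ

/-- The Fourier transform of `C_m g` is `freeSymbol m • 𝓕 g` (`m ≠ 0`): this is Mathlib's
definition of the Fourier multiplier, unfolded using temperate growth of the symbol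
(`freeSymbol_hasTemperateGrowth`). Glimm–Jaffe §6.2, (6.2.10) (`C = (-Δ + m²)⁻¹`). [folklore] -/
theorem fourier_freeCovarianceOp_apply {m : ℝ} (hm : m ≠ 0) (g : 𝓢(E, ℂ)) (ξ : E) :
    (𝓕 (freeCovarianceOp m g) : 𝓢(E, ℂ)) ξ = (freeSymbol m ξ : ℂ) * (𝓕 g : 𝓢(E, ℂ)) ξ := by
  have hg : Function.HasTemperateGrowth fun ξ : E => (freeSymbol m ξ : ℂ) :=
    Function.HasTemperateGrowth.comp Function.Complex.hasTemperateGrowth_ofReal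
      (freeSymbol_hasTemperateGrowth hm)
  simp only [freeCovarianceOp, SchwartzMap.fourierMultiplierCLM_apply]
  rw [FourierTransform.fourier_fourierInv_eq, SchwartzMap.smulLeftCLM_apply_apply hg]
  simp

/-- Plancherel form of the free covariance: for `m ≠ 0`,
`C_m(f, g) = ∫ conj (f x) (C_m g)(x) dx = ⟪f, C_m g⟫_{L²}`. Proved from Mathlib's Plancherel
theorem for Schwartz functions (`SchwartzMap.integral_inner_fourier_fourier`) and the multiplier
identity `fourier_freeCovarianceOp_apply`. Glimm–Jaffe §6.2: (6.2.1) `C(f, g) ≡ ⟨f, C g⟩` with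
(6.2.10) `C = (-Δ + m²)⁻¹`. [cite: GlimmJaffeQP1987, §6.2 (6.2.1), (6.2.10)] -/
theorem freeCovariance_eq_integral_mul_op {m : ℝ} (hm : m ≠ 0) (f g : 𝓢(E, ℂ)) :
    freeCovariance m f g = ∫ x, conj (f x) * freeCovarianceOp m g x := by
  have h := SchwartzMap.integral_inner_fourier_fourier f (freeCovarianceOp m g)
  simp only [inner] at h
  unfold freeCovariance
  calc ∫ ξ, conj ((𝓕 f : 𝓢(E, ℂ)) ξ) * (𝓕 g : 𝓢(E, ℂ)) ξ * (freeSymbol m ξ : ℂ)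
      = ∫ ξ, (𝓕 (freeCovarianceOp m g) : 𝓢(E, ℂ)) ξ * (starRingEnd ℂ) ((𝓕 f : 𝓢(E, ℂ)) ξ) := by
        congr 1
        funext ξ
        rw [fourier_freeCovarianceOp_apply hm]
        ring
    _ = ∫ x, freeCovarianceOp m g x * (starRingEnd ℂ) (f x) := h
    _ = ∫ x, conj (f x) * freeCovarianceOp m g x := by
        congr 1
        funext x
        ring

/-- The free covariance is Hermitian: `conj C_m(f, g) = C_m(g, f)` (for every `m`, junk case
included: both sides are the Bochner integral of conjugate integrands). Glimm–Jaffe §6.2,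
(6.2.10). [folklore] -/
theorem freeCovariance_conj_symm (m : ℝ) (f g : 𝓢(E, ℂ)) :
    conj (freeCovariance m f g) = freeCovariance m g f := by
  unfold freeCovariance
  rw [← integral_conj]
  congr 1
  funext ξ
  simp only [map_mul, Complex.conj_conj, Complex.conj_ofReal]
  ring

/-- Momentum-space form of the diagonal: `C_m(f, f) = ∫ ‖𝓕 f ξ‖² ((2π‖ξ‖)² + m²)⁻¹ dξ`, as the
coercion of a real Bochner integral (for every `m`). Glimm–Jaffe §6.2, (6.2.10). [folklore] -/
theorem freeCovariance_self_eq_ofReal (m : ℝ) (f : 𝓢(E, ℂ)) :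
    freeCovariance m f f = ((∫ ξ, ‖(𝓕 f : 𝓢(E, ℂ)) ξ‖ ^ 2 * freeSymbol m ξ : ℝ) : ℂ) := by
  unfold freeCovariance
  rw [← integral_complex_ofReal]
  congr 1
  funext ξ
  push_cast
  rw [← Complex.conj_mul']

/-- The free covariance is a positive form: `C_m(f, f) = ∫ |𝓕 f ξ|² ((2π‖ξ‖)² + m²)⁻¹ dξ` is a
nonnegative real (for every `m`, including the junk case). Glimm–Jaffe §6.2 ((6.2.1): `C` is a
positive form; (6.2.10)). [folklore] -/
theorem freeCovariance_self_nonneg (m : ℝ) (f : 𝓢(E, ℂ)) :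
    0 ≤ (freeCovariance m f f).re ∧ (freeCovariance m f f).im = 0 := by
  rw [freeCovariance_self_eq_ofReal, Complex.ofReal_re, Complex.ofReal_im]
  exact ⟨integral_nonneg fun ξ => mul_nonneg (sq_nonneg _) (freeSymbol_nonneg m ξ), rfl⟩

/-- For `m ≠ 0` the free covariance is nondegenerate: `C_m(f, f) = 0 ↔ f = 0`. Named fact
(D-0014). Glimm–Jaffe §6.2: (6.2.1) `C` is a positive continuous *nondegenerate* bilinear form,
with (6.2.10) `C = (-Δ + m²)⁻¹`. [cite: GlimmJaffeQP1987, §6.2 (6.2.1), (6.2.10)] -/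
def freeCovariance_self_eq_zero_iff : Prop :=
  ∀ {m : ℝ}, m ≠ 0 → ∀ f : 𝓢(E, ℂ),
    freeCovariance m f f = 0 ↔ f = 0

/-- The real free covariance is symmetric, `C_m(f, g) = C_m(g, f)` (real part of the Hermitian
symmetry `freeCovariance_conj_symm`). Glimm–Jaffe §6.2, (6.2.10). [folklore] -/
theorem freeCovarianceReal_comm (m : ℝ) (f g : 𝓢(E, ℝ)) :
    freeCovarianceReal m f g = freeCovarianceReal m g f := by
  unfold freeCovarianceReal
  rw [← freeCovariance_conj_symm, Complex.conj_re]

/-- The real free covariance is nonnegative on the diagonal, `0 ≤ C_m(f, f)`.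
Glimm–Jaffe §6.2. [folklore] -/
theorem freeCovarianceReal_self_nonneg (m : ℝ) (f : 𝓢(E, ℝ)) :
    0 ≤ freeCovarianceReal m f f :=
  (freeCovariance_self_nonneg m (ofRealTest f)).1

/-- The free covariance is jointly continuous on `𝓢(E, ℝ) × 𝓢(E, ℝ)` when it is everywhere
defined (`m ≠ 0`, or `m = 0` in dimension `≥ 3`); in particular `f ↦ exp (-½ C_m(f, f))` is a
continuous characteristic functional (input to Minlos' theorem). Named fact (D-0014).
Glimm–Jaffe §6.2: (6.2.1) `C` is a positive *continuous* nondegenerate bilinear form on `𝓢 × 𝓢`,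
with (6.2.10)–(6.2.11) `C = (-Δ + m²)⁻¹` (`m = 0` admitted for `d ≥ 3` by (6.2.8)).
[cite: GlimmJaffeQP1987, §6.2 (6.2.1), (6.2.10)] -/
def continuous_freeCovarianceReal : Prop :=
  ∀ {m : ℝ}, (m ≠ 0 ∨ 3 ≤ Module.finrank ℝ E) →
    Continuous fun p : 𝓢(E, ℝ) × 𝓢(E, ℝ) => freeCovarianceReal m p.1 p.2

/-- Translation invariance of the free covariance: `C_m(f(· - a), g(· - a)) = C_m(f, g)`
(the phases `e^{-2πi⟪a, ξ⟫}` of `𝓕` cancel in `conj (𝓕 f) 𝓕 g`). Named fact (D-0014).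
Glimm–Jaffe §7.1 ("the essential properties of `C` [= (7.1.1) `(-Δ + m²)⁻¹`] ... namely Euclidean
invariance"), Thm. 6.2.4 (the Gaussian measure of `C` is invariant).
[cite: GlimmJaffeQP1987, §7.1 (7.1.1)] -/
def freeCovariance_translate : Prop :=
  ∀ (m : ℝ) (a : E) (f g : 𝓢(E, ℂ)),
    freeCovariance m (translateTest a f) (translateTest a g) = freeCovariance m f g

/-- Invariance of the free covariance under linear isometries (rotations and reflections):
`C_m(f ∘ L⁻¹, g ∘ L⁻¹) = C_m(f, g)`, since `𝓕 (f ∘ L⁻¹) = 𝓕 f ∘ L⁻¹`, `‖L⁻¹ ξ‖ = ‖ξ‖` and `L`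
preserves Lebesgue measure. Named fact (D-0014). Glimm–Jaffe §7.1 (Euclidean invariance of
`C = (-Δ + m²)⁻¹`, (7.1.1)), Thm. 6.2.4. [cite: GlimmJaffeQP1987, §7.1 (7.1.1)] -/
def freeCovariance_linAct : Prop :=
  ∀ (m : ℝ) (L : E ≃ₗᵢ[ℝ] E) (f g : 𝓢(E, ℂ)),
    freeCovariance m (linActTest L f) (linActTest L g) = freeCovariance m f g

/-- Euclidean invariance of the free covariance: `C_m(f ∘ γ⁻¹, g ∘ γ⁻¹) = C_m(f, g)` for every
Euclidean motion `γ` — witness theorem over the named facts `freeCovariance_translate` and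
`freeCovariance_linAct` (`euclidActTest γ = translateTest (γ 0) ∘ linActTest R`).
Glimm–Jaffe §7.1 (Euclidean invariance of `C`). [cite: GlimmJaffeQP1987, §7.1 (7.1.1)] -/
theorem freeCovariance_euclidAct (h₁ : freeCovariance_translate (E := E))
    (h₂ : freeCovariance_linAct (E := E)) (m : ℝ) (γ : E ≃ᵃⁱ[ℝ] E) (f g : 𝓢(E, ℂ)) :
    freeCovariance m (euclidActTest γ f) (euclidActTest γ g) = freeCovariance m f g := by
  simp only [euclidActTest, ContinuousLinearMap.coe_comp, Function.comp_apply]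
  exact (h₁ m (γ 0) _ _).trans (h₂ m _ f g)

omit [FiniteDimensional ℝ E] [MeasurableSpace E] [BorelSpace E] in
/-- Complexification commutes with the Euclidean action on test functions. [folklore] -/
theorem ofRealTest_euclidActTest (γ : E ≃ᵃⁱ[ℝ] E) (f : 𝓢(E, ℝ)) :
    ofRealTest (euclidActTest γ f) = euclidActTest γ (ofRealTest f) := by
  ext x
  simp

/-- Euclidean invariance of the real free covariance — witness theorem over the named facts
`freeCovariance_translate` and `freeCovariance_linAct`. Glimm–Jaffe §7.1 (Euclidean invariance
of `C`). [cite: GlimmJaffeQP1987, §7.1 (7.1.1)] -/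
theorem freeCovarianceReal_euclidAct (h₁ : freeCovariance_translate (E := E))
    (h₂ : freeCovariance_linAct (E := E)) (m : ℝ) (γ : E ≃ᵃⁱ[ℝ] E) (f g : 𝓢(E, ℝ)) :
    freeCovarianceReal m (euclidActTest γ f) (euclidActTest γ g) = freeCovarianceReal m f g := by
  unfold freeCovarianceReal
  rw [ofRealTest_euclidActTest, ofRealTest_euclidActTest, freeCovariance_euclidAct h₁ h₂]

end Covariance

/-! ### Reflection positivity -/

section ReflectionPositivity

variable {d : ℕ} [NeZero d]

/-- **Reflection positivity of the free covariance** (Glimm–Jaffe Prop. 6.2.5: "Let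
`C = (-Δ + m²)⁻¹` ... Moreover `C` is reflection-positive", with Def. 6.2.1: for every `f ∈ 𝓢(ℝ^d)`
supported at positive times, `0 ≤ ⟨θ f, C f⟩`): for a test function `f` on `ℝ^d` supported at
positive times, `⟪θ f, C_m f⟫_{L²} = C_m(θ f, f)` is a nonnegative real, where
`(θ f)(x⁰, x⃗) = f(-x⁰, x⃗)`. Hypothesis: `m ≠ 0` (the massless case is the separate fact
`freeCovarianceMassless_reflectionPositive`). Named fact (D-0014).
[cite: GlimmJaffeQP1987, Prop. 6.2.5] -/
def freeCovariance_reflectionPositive : Prop :=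
  ∀ {m : ℝ}, m ≠ 0 → ∀ {f : 𝓢(EuclideanSpace ℝ (Fin d), ℂ)}, IsPositiveTime f →
    0 ≤ (freeCovariance m (thetaTest d f) f).re ∧
      (freeCovariance m (thetaTest d f) f).im = 0

/-- **Reflection positivity of the massless free covariance** in dimension `d ≥ 3`:
`C_0(θ f, f) = ⟪θ f, (-Δ)⁻¹ f⟫_{L²}` is a nonnegative real for `f` supported at positive times.
Glimm–Jaffe Thm. 6.2.4: for every tempered positive measure `dρ` restricted by (6.2.8) — no
restriction at `m² = 0` when `d ≥ 3` — the covariance (6.2.11) `C = ∫ (-Δ + m²)⁻¹ dρ(m²)` (here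
`dρ = δ₀`, `C = (-Δ)⁻¹`) is that of a reflection-positive invariant Gaussian measure, and by
Thm. 6.2.2 `dφ_C` is reflection positive iff `C` is. Named fact (D-0014).
[cite: GlimmJaffeQP1987, Thm. 6.2.4 with (6.2.8), (6.2.11), Thm. 6.2.2] -/
def freeCovarianceMassless_reflectionPositive : Prop :=
  3 ≤ d → ∀ {f : 𝓢(EuclideanSpace ℝ (Fin d), ℂ)}, IsPositiveTime f →
    0 ≤ (freeCovarianceMassless (thetaTest d f) f).re ∧
      (freeCovarianceMassless (thetaTest d f) f).im = 0

/-- Complexification commutes with time reflection of test functions. [folklore] -/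
theorem ofRealTest_thetaTest (f : 𝓢(EuclideanSpace ℝ (Fin d), ℝ)) :
    ofRealTest (thetaTest d f) = thetaTest d (ofRealTest f) := by
  ext x
  simp

/-- Complexification preserves positive-time support. [folklore] -/
theorem IsPositiveTime.ofRealTest {f : 𝓢(EuclideanSpace ℝ (Fin d), ℝ)} (hf : IsPositiveTime f) :
    IsPositiveTime (ofRealTest f) := by
  refine Set.Subset.trans (closure_mono fun x hx => ?_) hf
  simpa [Function.mem_support, ofRealTest_apply] using hx

/-- Reflection positivity of the real free covariance: `0 ≤ C_m(θ f, f)` for real positive-time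
`f`, in the massive case or the massless case in dimension `≥ 3` — witness theorem over the named
facts `freeCovariance_reflectionPositive` and `freeCovarianceMassless_reflectionPositive`.
Glimm–Jaffe Prop. 6.2.5, Thm. 6.2.4 (this is OS3 for the free field, via Thm. 6.2.2).
[cite: GlimmJaffeQP1987, Prop. 6.2.5] -/
theorem freeCovarianceReal_reflectionPositive (h : freeCovariance_reflectionPositive (d := d))
    (h₀ : freeCovarianceMassless_reflectionPositive (d := d))
    {m : ℝ} (hm : m ≠ 0 ∨ (m = 0 ∧ 3 ≤ d)) {f : 𝓢(EuclideanSpace ℝ (Fin d), ℝ)}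
    (hf : IsPositiveTime f) : 0 ≤ freeCovarianceReal m (thetaTest d f) f := by
  unfold freeCovarianceReal
  rw [ofRealTest_thetaTest]
  rcases hm with hm | ⟨rfl, hd⟩
  · exact (h hm hf.ofRealTest).1
  · simpa only [freeCovarianceMassless_eq] using (h₀ hd hf.ofRealTest).1

end ReflectionPositivity

/-! ### Discharge of `freeCovariance_translate` -/

section Discharge

open scoped RealInnerProductSpace

variable {E : Type*} [NormedAddCommGroup E] [InnerProductSpace ℝ E] [FiniteDimensional ℝ E]
  [MeasurableSpace E] [BorelSpace E]

/-- Phase identity for the Fourier transform of a translated Schwartz function: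
`𝓕 (f(· - a)) ξ = 𝐞(-⟪a, ξ⟫) • 𝓕 f ξ` (Mathlib's kernel is `𝐞(-⟪v, ξ⟫) = e^{-2πi⟪v, ξ⟫}`).
This is `VectorFourier.fourierIntegral_comp_add_right` transported along
`SchwartzMap.fourier_coe`. [folklore] -/
theorem fourier_translateTest_apply (a : E) (f : 𝓢(E, ℂ)) (ξ : E) :
    (𝓕 (translateTest a f) : 𝓢(E, ℂ)) ξ = 𝐞 (-⟪a, ξ⟫) • (𝓕 f : 𝓢(E, ℂ)) ξ := by
  have h : ((translateTest a f : 𝓢(E, ℂ)) : E → ℂ) = (f : E → ℂ) ∘ fun v => v + -a := by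
    funext x
    simp [sub_eq_add_neg]
  rw [SchwartzMap.fourier_coe, SchwartzMap.fourier_coe, h]
  change VectorFourier.fourierIntegral 𝐞 volume (innerₗ E) _ ξ =
    𝐞 (-⟪a, ξ⟫) • VectorFourier.fourierIntegral 𝐞 volume (innerₗ E) _ ξ
  rw [VectorFourier.fourierIntegral_comp_add_right]
  simp only [innerₗ_apply_apply, inner_neg_left]

/-- The translation phases cancel in the momentum-space density `conj (𝓕 f) · 𝓕 g`:
`conj (𝓕 (f(· - a)) ξ) · 𝓕 (g(· - a)) ξ = conj (𝓕 f ξ) · 𝓕 g ξ`, since `conj 𝐞(c) · 𝐞(c) = 1`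
(`Circle.normSq_coe`). [folklore] -/
theorem conj_fourier_translateTest_mul (a : E) (f g : 𝓢(E, ℂ)) (ξ : E) :
    conj ((𝓕 (translateTest a f) : 𝓢(E, ℂ)) ξ) * (𝓕 (translateTest a g) : 𝓢(E, ℂ)) ξ =
      conj ((𝓕 f : 𝓢(E, ℂ)) ξ) * (𝓕 g : 𝓢(E, ℂ)) ξ := by
  rw [fourier_translateTest_apply, fourier_translateTest_apply, Circle.smul_def, Circle.smul_def,
    smul_eq_mul, smul_eq_mul, map_mul]
  set e : ℂ := (𝐞 (-⟪a, ξ⟫) : ℂ)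
  have he : conj e * e = 1 := by
    rw [mul_comm, Complex.mul_conj, Circle.normSq_coe, Complex.ofReal_one]
  calc conj e * conj ((𝓕 f : 𝓢(E, ℂ)) ξ) * (e * (𝓕 g : 𝓢(E, ℂ)) ξ)
      = (conj e * e) * (conj ((𝓕 f : 𝓢(E, ℂ)) ξ) * (𝓕 g : 𝓢(E, ℂ)) ξ) := by ring
    _ = conj ((𝓕 f : 𝓢(E, ℂ)) ξ) * (𝓕 g : 𝓢(E, ℂ)) ξ := by rw [he, one_mul]

/-- **Discharge** of the named fact `freeCovariance_translate` (translation invariance of the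
free covariance, `C_m(f(· - a), g(· - a)) = C_m(f, g)` for every `m`, `a`, `f`, `g`, junk case
`m = 0` included): the momentum-space integrands agree pointwise by
`conj_fourier_translateTest_mul`, so the two Bochner integrals defining `freeCovariance` coincide.
Source: Glimm–Jaffe §7.1, p. 113: the covariance `C` of the free field, characterised by (7.1.1)
`(-Δ + m²) C(x, y) = δ(x - y)`, has as "essential properties ... the axioms of Chapter 6.1,
namely Euclidean invariance, OS positivity, and regularity"; translation invariance is the
translation part of Euclidean invariance (OS2, §6.1 p. 85). The book gives no separate proof
(it is immediate from `C(x, y) = C(x - y)`); the Lean proof is the equivalent Fourier-side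
computation. [cite: GlimmJaffeQP1987, §7.1 (7.1.1)] -/
theorem freeCovariance_translate_holds : freeCovariance_translate (E := E) := by
  intro m a f g
  unfold freeCovariance
  congr 1
  funext ξ
  rw [conj_fourier_translateTest_mul]

end Discharge

end Literature.MathematicalPhysics.QuantumLattice
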